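import Literature.Barriers.SmoothPoincare4.SmallExoticaFrontierReductionLemma8Proofs
import Literature.Barriers.SmoothPoincare4.SmallExoticaFrontierReductionStandardModelProofs
import Literature.Topology.FourManifolds.ClosedOrientableSurfaces
import Literature.Topology.FourManifolds.RechartOrientation
import HarnessLib

/-!
# Akhmedov–Park 2010, Lemma 8: the genus-2 surface `Σ₂` and the model `Σ₂ × T²`, with their printed invariants

Proof file (theorems only, no definition, no named fact) continuing
`SmallExoticaFrontierReductionLemma8Proofs.lean` (the printed proof of Lemma 8 of A. Akhmedov,
B. D. Park, *Exotic smooth structures on small 4-manifolds with odd signatures*, Invent. Math.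
181 (2010) 577–603 = arXiv:math/0701829, formalised up to its two non-classical inputs) for the
Seiberg–Witten leaf `Literature.Barriers.SmoothPoincare4.akhmedovPark2010_lemma8_invariants`.
That file's §8–§9 derive the printed Euler characteristics of step (a),
"`e(X₁(m)) = e(Y₁(1,1)) + e(Z''(1,m)) - 2e(Σ₂) = 0 + 1 + 4 = 5`", for ANY closed connected
`ℤ`-oriented surface `F` with `rank H₁(F; ℤ) = 4` in the role of `Σ₂` ("only `e(Σ₂) = -2` (the
genus-2 surface itself) and the decompositions are left to the construction"), and
`SignatureProductCircle.lean` derives `σ(F × T²) = 0` for every orientation of a recharted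
`F × S¹ × S¹`.  The surface now exists in the tree
(`Literature.Topology.FourManifolds.exists_genusTwoSurface`: `Σ₂ = T² # T²`, closed, smooth,
connected, `ℤ`-oriented, `H₁ ≅ ℤ⁴`), and recharted products of oriented manifolds with circles
are `ℤ`-orientable (`RechartOrientation.lean`), so the two printed manifolds of the `Y₁`-side of
the construction exist with their printed invariants:

* `akhmedovPark2010_exists_sigmaTwo` — **the genus-2 surface `Σ₂`** (§2: "`Σ₂ × T²`"; §9: the
  surface of the normal connected sum `X₁(m) = Y₁(1,1) #_ψ Z''(1,m)`, "`-2e(Σ₂) = +4`"): a closed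
  connected smooth `ℤ`-oriented surface, a connected sum of two tori, with `rank H₁ = 4`,
  finitely generated homology vanishing from degree `4` on, and **`e(Σ₂) = -2`**
  (`relEuler_surface_of_finrank_one_eq_four`).
* `akhmedovPark2010_exists_sigmaTwo_prod_torus` — **the model `Σ₂ × T²` of §2** (the minimal
  symplectic `4`-manifold from which `Y₁(1/p, 1/q)` is obtained by four Luttinger surgeries, eq.
  at the start of §9): a closed connected smooth `4`-manifold `X ≃ₜ (Σ₂ × S¹) × S¹`, charted on
  `ℝ⁴` and `C^∞`, which is `ℤ`-orientable, has **`σ(X, μ) = 0` for every `ℤ`-orientation `μ`**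
  (the printed "`σ(Y₁(1,1)) = 0`" before surgery; `exists_surface_prod_torus_oriented_model`) and
  **`e(X) = 0`** with finitely generated homology (the printed "`e(Y₁(1,1)) = 0`" before surgery;
  `FinRelHomology.prod_torus`, `χ(K × T²) = 0`).

* `akhmedovPark2010_standardModel_invariants` — **the printed invariants
  `(e, σ, π₁)(X₁(m)) = (5, -1, 1)` are jointly realised** by the standard smooth structure on the
  homeomorphism type, the closed smooth simply connected `(S² × S²) # ℂℙ²`
  (`exists_closed_simplyConnected_finrank_eq_three_signature_eq_neg_one` of
  `SmallExoticaFrontierReductionStandardModelProofs.lean`: `rank H²/T = 3`, `σ = -1`), now with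
  the Euler characteristic itself, `e = rank H²/T + 2 = 5` (§5 of the sibling Lemma 8 file,
  `finrank_freeCohomology_two_eq_euler_sub_two`), and finiteness of its homology.

What is NOT formalised: Luttinger / torus surgery (and the invariance of `e`, `σ` under it beyond
the cover form of §8 of the sibling file), the symplectic normal connected sum, and the
Seiberg–Witten distinctness — the leaf stays undischarged.

## References

* [AkhmedovPark2010] A. Akhmedov, B. D. Park, Invent. Math. 181 (2010) 577–603 =
  arXiv:math/0701829: §2 (the manifolds `Σ₂ × T²`, `Y₁(1/p, 1/q)`), §9 Lemma 8 and its proof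
  ("`e(X₁(m)) = 0 + 1 + 4 = 5`, `σ(X₁(m)) = 0 + (-1) = -1`").
* [HatcherAT2002] A. Hatcher, *Algebraic Topology* (2002), Ch. 0 p. 5, Example 2.36
  (`H₁(M_g) = ℤ^{2g}`), §2.2 Thm. 2.44, §3.3 Thm. 3.26.
* [Kirby1989] R. C. Kirby, *The Topology of 4-Manifolds*, LNM 1374 (1989), Ch. II §5 p. 27
  (`σ(M³ × S¹) = 0`).
-/

noncomputable section

open scoped Manifold ContDiff
open Set Module
open Literature.AlgebraicTopology.SingularHomology
open Literature.Topology.FourManifolds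

namespace Literature.Barriers.SmoothPoincare4

/-- **The genus-2 surface `Σ₂` of Akhmedov–Park 2010, with `e(Σ₂) = -2`.** There is a closed
connected smooth surface `F` in `Type` (Hausdorff, second countable, compact, charted on `ℝ²`,
`C^∞`) with a `ℤ`-orientation `μ`, which is a connected sum `T # T` of two copies of a smooth
surface `T ≃ₜ S¹ × S¹` (`exists_genusTwoSurface`: Hatcher Ch. 0 p. 5, Example 2.36), has
`rank H₁(F; ℤ) = 4`, finitely generated integral homology vanishing from degree `4` on, and Euler
characteristic `e(F) = 1 - 4 + 1 = -2` (`relEuler_surface_of_finrank_one_eq_four`) — the printed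
"`-2e(Σ₂) = 4`" of the proof of Lemma 8.
[cite: AkhmedovPark2010, §9, proof of Lemma 8 ("e(X₁(m)) = e(Y₁(1,1)) + e(Z''(1,m)) − 2e(Σ₂) = 0 + 1 + 4")] [cite: HatcherAT2002, Ch. 0 p. 5 and Example 2.36] -/
theorem akhmedovPark2010_exists_sigmaTwo :
    ∃ (F : Type) (_ : TopologicalSpace F) (_ : T2Space F) (_ : SecondCountableTopology F)
      (_ : ChartedSpace (EuclideanSpace ℝ (Fin 2)) F) (_ : IsManifold (𝓡 2) ∞ F)
      (_ : CompactSpace F) (_ : ConnectedSpace F) (_ : HomologicalOrientation ℤ F 2),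
      (∃ (T : Type) (_ : TopologicalSpace T) (_ : T2Space T)
          (_ : ChartedSpace (EuclideanSpace ℝ (Fin 2)) T),
          Nonempty (T ≃ₜ Circle × Circle) ∧ IsConnectedSum (𝓡 2) (𝓡 2) (𝓡 2) T T F) ∧
        Module.finrank ℤ (singularHomology ℤ ℤ F 1) = 4 ∧
          FinRelHomology ℤ ℤ F ∅ 4 ∧ relEuler ℤ ℤ F ∅ = -2 := by
  obtain ⟨F, _, _, _, _, _, _, _, μ, hT, ⟨l⟩⟩ := exists_genusTwoSurface
  have h4 : Module.finrank ℤ (singularHomology ℤ ℤ F 1) = 4 := by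
    rw [← l.finrank_eq, finrank_fintype_fun_eq_card, Fintype.card_fin]
  obtain ⟨hfin, he⟩ := relEuler_surface_of_finrank_one_eq_four F μ h4
  exact ⟨F, inferInstance, inferInstance, inferInstance, inferInstance, inferInstance,
    inferInstance, inferInstance, μ, hT, h4, hfin, he⟩

/-- **The model `Σ₂ × T²` of Akhmedov–Park 2010, §2: closed, smooth, `ℤ`-orientable, with
`σ = 0` and `e = 0`.** There are a genus-2 surface `F` as in `akhmedovPark2010_exists_sigmaTwo`
(`e(F) = -2`, `rank H₁(F; ℤ) = 4`) and a closed connected smooth `4`-manifold `X` in `Type`,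
charted on `ℝ⁴` and `C^∞`, homeomorphic to `(F × S¹) × S¹`, which is `ℤ`-orientable, all of whose
`ℤ`-orientations have signature `0` (`exists_surface_prod_torus_oriented_model`: the reflection of
a circle factor reverses the orientation; Kirby II §5 p. 27), and whose integral homology is
finitely generated, zero from degree `6` on, with Euler characteristic `e(X) = 0`
(`FinRelHomology.prod_torus`: `χ(K × T²) = 0`, transported along
`X ≃ₜ (F × S¹) × S¹ ≃ₜ F × (ℝ/ℤ)²`).  These are the printed `e(Y₁(1,1)) = 0`, `σ(Y₁(1,1)) = 0` of
the proof of Lemma 8 for the manifold `Σ₂ × T²` BEFORE the four Luttinger surgeries producing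
`Y₁(1,1)` (which preserve `e` and `σ`; not formalised).
[cite: AkhmedovPark2010, §2 and §9, proof of Lemma 8 ("e(X₁(m)) = 0 + 1 + 4", "σ(X₁(m)) = 0 + (−1)")] [cite: Kirby1989, Ch. II §5 p. 27] -/
theorem akhmedovPark2010_exists_sigmaTwo_prod_torus :
    ∃ (F : Type) (_ : TopologicalSpace F) (_ : T2Space F) (_ : SecondCountableTopology F)
      (_ : ChartedSpace (EuclideanSpace ℝ (Fin 2)) F) (_ : IsManifold (𝓡 2) ∞ F)
      (_ : CompactSpace F) (_ : ConnectedSpace F) (_ : HomologicalOrientation ℤ F 2)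
      (X : Type) (_ : TopologicalSpace X) (_ : T2Space X) (_ : SecondCountableTopology X)
      (_ : ChartedSpace (EuclideanSpace ℝ (Fin 4)) X) (_ : IsManifold (𝓡 4) ∞ X)
      (_ : CompactSpace X) (_ : ConnectedSpace X),
      (relEuler ℤ ℤ F ∅ = -2 ∧ Module.finrank ℤ (singularHomology ℤ ℤ F 1) = 4) ∧
        Nonempty (X ≃ₜ (F × Circle) × Circle) ∧ IsOrientableOver ℤ X 4 ∧
          (∀ μ : HomologicalOrientation ℤ X 4, μ.signature = 0) ∧
            FinRelHomology ℤ ℤ X ∅ 6 ∧ relEuler ℤ ℤ X ∅ = 0 := by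
  obtain ⟨F, _, _, _, _, _, _, _, μF, -, h4, hfin, he⟩ := akhmedovPark2010_exists_sigmaTwo
  obtain ⟨X, _, _, _, _, _, _, _, ⟨eX⟩, hO, hσ⟩ := exists_surface_prod_torus_oriented_model F μF
  -- `X ≃ₜ (F × S¹) × S¹ ≃ₜ F × (ℝ/ℤ × ℝ/ℤ)`
  let eC : Circle ≃ₜ AddCircle (1 : ℝ) := (AddCircle.homeomorphCircle one_ne_zero).symm
  let e : X ≃ₜ F × (AddCircle (1 : ℝ) × AddCircle (1 : ℝ)) :=
    (eX.trans (((Homeomorph.refl F).prodCongr eC).prodCongr eC)).trans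
      (Homeomorph.prodAssoc F (AddCircle (1 : ℝ)) (AddCircle (1 : ℝ)))
  obtain ⟨hfinT, heT⟩ := FinRelHomology.prod_torus ℤ ℤ hfin
  refine ⟨F, inferInstance, inferInstance, inferInstance, inferInstance, inferInstance,
    inferInstance, inferInstance, μF, X, inferInstance, inferInstance, inferInstance, inferInstance,
    inferInstance, inferInstance, inferInstance, ⟨he, h4⟩, ⟨eX⟩, hO, hσ, ?_, ?_⟩
  · exact hfinT.of_homeomorph e.symm (fun _ hx => False.elim hx) (fun _ hx => False.elim hx)
  · rw [← heT]
    exact relEuler_eq_of_homeomorph (R := ℤ) (M := ℤ) (A := (∅ : Set X)) e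
      (fun _ hx => False.elim hx) (fun _ hx => False.elim hx)

/-- **The printed invariants `(e, σ, π₁) = (5, -1, 1)` of `X₁(m)` are jointly realised by the
standard model `(S² × S²) # ℂℙ²`** (the standard smooth structure on the homeomorphism type
`ℂℙ² # 2ℂℙ²bar` of Lemma 8; Akhmedov–Park 2010, proof of Lemma 8: "`e(X₁(m)) = 5`,
`σ(X₁(m)) = -1` … `π₁(X₁(m)) = 1`"): a closed smooth simply connected `4`-manifold `P` in `Type`
with a `ℤ`-orientation of signature `-1`, `rank H²(P; ℤ)/T = 3`, finitely generated homology
vanishing from degree `5` on, and `e(P) = 5` — `e = rank H²/T + 2` for simply connected closed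
`4`-manifolds (`finrank_freeCohomology_two_eq_euler_sub_two`, §5 of the sibling Lemma 8 file;
Kirby 1989, Ch. II §1).  What such a constant family lacks of the leaf is exactly pairwise
non-diffeomorphism (`akhmedovPark2010_lemma8_invariants_sans_distinctness`).
[cite: AkhmedovPark2010, §9, proof of Lemma 8 ("e(X₁(m)) = 5, σ(X₁(m)) = −1, π₁(X₁(m)) = 1")] [cite: Kirby1989, Ch. II §1] -/
theorem akhmedovPark2010_standardModel_invariants :
    ∃ (P : Type) (_ : TopologicalSpace P) (_ : T2Space P) (_ : SecondCountableTopology P)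
      (_ : ChartedSpace (EuclideanSpace ℝ (Fin 4)) P) (_ : IsManifold (𝓡 4) ∞ P)
      (_ : CompactSpace P) (_ : SimplyConnectedSpace P) (μ : HomologicalOrientation ℤ P 4),
      Module.finrank ℤ ↥(freeCohomology ℤ P 2) = 3 ∧ μ.signature = -1 ∧
        FinRelHomology ℤ ℤ P ∅ 5 ∧ relEuler ℤ ℤ P ∅ = 5 := by
  obtain ⟨P, _, _, _, _, _, _, _, μ, hr, hσ⟩ :=
    exists_closed_simplyConnected_finrank_eq_three_signature_eq_neg_one
  have hfin := finRelHomology_of_compactSpace_four P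
  refine ⟨P, inferInstance, inferInstance, inferInstance, inferInstance, inferInstance,
    inferInstance, inferInstance, μ, hr, hσ, hfin, ?_⟩
  have h := finrank_freeCohomology_two_eq_euler_sub_two (M := P)
  rw [hr] at h
  rw [hfin.relEuler_empty_eq_sum]
  push_cast at h
  linarith

end Literature.Barriers.SmoothPoincare4
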